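import Mathlib.Data.Nat.Log
import Mathlib.Data.Nat.Sqrt
import Literature.Computability.Complexity.Promise
import Literature.Computability.MetaComplexity.UniversalMachine
import Literature.Computability.MetaComplexity.DistProblems
import HarnessLib

/-!
# Complexity meta: gap versions of `MINKT` and `MK^tP`

Topic `Literature/Computability/MetaComplexity` (definition item `defn-gapMKtimeP`, route
`PneNP/ktlang`). Companion to `UniversalMachine.lean` (`U.ktAt`, `U.kt`, `U.MINKT`, `U.MKtimeP`)
following the pattern of `gapMCSP` in `MCSP.lean`.

For a clocked universal machine `U : UniversalMachine` we define two promise problems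
(`Literature.Computability.Complexity.PromiseProblem`):

* `U.gapMINKT σ τ` — Hirahara's `Gap_{σ,τ}MINKT` (FOCS 2018 / ECCC TR18-138, Def. 3.6): for
  `σ τ : ℕ → ℕ → ℕ`, instances are Ko's triples `⟨x, 1^t, 1^s⟩`
  (encoded `boolPair x (boolPair (unaryEncodeNat t) (unaryEncodeNat s))` exactly as in `U.MINKT`),
  yes-instances those with `K^t(x) ≤ s`, no-instances those with `K^{τ(|x|,t)}(x) > σ(|x|, s)`.
  For `σ(n,s) = s`, `τ(n,t) = t` this is the promise problem of the language `MINKT`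
  (`gapMINKT_self`).
* `U.gapMKtimeP t₁ t₂ s₁ s₂` — the fixed-parameter version `Gap-MK^tP`: for time bounds
  `t₁, t₂ : ℕ → ℕ` and thresholds `s₁, s₂ : ℕ → ℕ` (functions of `|x|`), yes-instances
  `{x | K^{t₁(|x|)}(x) ≤ s₁(|x|)} = MK^{t₁}P[s₁]`, no-instances `{x | K^{t₂(|x|)}(x) > s₂(|x|)}`.
  This is the specialisation of `Gap_{σ,τ}MINKT` to `t, s` given as functions of the input
  length (Hirahara 2018, Def. 3.6 with §1's `MK^tP` convention of Liu–Pass 2020, §2.2); for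
  `t₁ = t₂`, `s₁ = s₂` it is the promise problem of `U.MKtimeP t s` (`gapMKtimeP_self`).

API: unfolding/membership lemmas (`gapMINKT_yes`, `boolPair_mem_gapMINKT_no_iff`,
`gapMKtimeP_yes`, `mem_gapMKtimeP_no_iff`), disjointness under the intended monotonicity
hypotheses (`gapMINKT_disjoint`, `gapMKtimeP_disjoint`, real proofs from `ktAt_anti`), the
`self` lemmas, and antitonicity of the no-parts in the parameters.

Named fact (statement only, `def … : Prop`, D-0014): `Hirahara2018_gapMINKT_mem_PromiseP`,
Hirahara's Corollary 4.23 (`DistNP ⊆ AvgP ⇒ Gap_{σ,τ}MINKT ∈ Promise-P` for some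
`σ(n,s) = s + O((log n)√s + (log n)²)` and some polynomial `τ`).

## Design choices

* Both promise problems are functions of `U` (dot notation on `UniversalMachine`), like `U.MINKT`
  and `U.MKtimeP`: every `K^t` statement of the library quantifies over `U`.
* `σ` is a *threshold* `σ(n, s)` (Hirahara's convention, `σ(n,s) ≥ s`), not an additive gap; the
  additive form `s + g(n,s)` is the instance `σ := fun n s => s + g n s`.
* Hirahara's side conditions `σ(n,s) ≥ s`, `τ(n,t) ≥ t` are **not** baked into the definition
  (they are hypotheses of `gapMINKT_disjoint` and conjuncts of the named fact), as for `gapMCSP`.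
* `K^t` is `ℕ∞`-valued (`⊤` = "no program prints `x` in time `t`"); thresholds are cast to `ℕ∞`,
  so a string that is not printable within the no-time-bound is always a no-instance, matching
  the paper's `min ∅ = +∞` reading.
* Mathlib has no Kolmogorov complexity, `MINKT` or promise problems (searched `MINKT`, `Kolmogorov`,
  `PromiseProblem`); nothing is duplicated.

## References

* S. Hirahara, *Non-black-box worst-case to average-case reductions within NP*, FOCS 2018,
  247–258; full version ECCC TR18-138 (rev. 1, 2019): Def. 3.4 (`MINKT`), Def. 3.6
  (`Gap_{σ,τ}MINKT`), Thm 4.21 (main), Cor. 4.23.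
* K.-I. Ko, *On the complexity of learning minimum time-bounded Turing machines*, SIAM J. Comput.
  20 (1991) — `MINKT`.
* Y. Liu, R. Pass, *On one-way functions and Kolmogorov complexity*, FOCS 2020, §2.2 — `MK^tP[s]`.
-/

namespace Literature.Computability.MetaComplexity

open _root_.Computability Complexity

namespace UniversalMachine

variable (U : UniversalMachine)

/-! ### `Gap_{σ,τ} MINKT` -/

/-- Hirahara's approximation version `Gap_{σ,τ}MINKT` of Ko's `MINKT`, for
`σ τ : ℕ → ℕ → ℕ` (intended: `σ(n,s) ≥ s`, `τ(n,t) ≥ t`): the promise problem whose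
yes-instances are the triples `⟨x, 1^t, 1^s⟩` with `K^t(x) ≤ s` (i.e. `U.MINKT`) and whose
no-instances are the triples `⟨x, 1^t, 1^s⟩` with `K^{t'}(x) > σ(|x|, s)` for `t' := τ(|x|, t)`.
Triples are encoded `boolPair x (boolPair (unaryEncodeNat t) (unaryEncodeNat s))` as in `U.MINKT`.
When `σ(n,s) = s` and `τ(n,t) = t` this is `MINKT` as a promise problem (`gapMINKT_self`).
[cite: Hirahara2018, Def. 3.6] -/
def gapMINKT (σ τ : ℕ → ℕ → ℕ) : PromiseProblem :=
  ⟨U.MINKT,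
    {w | ∃ (x : List Bool) (t s : ℕ),
      w = boolPair x (boolPair (unaryEncodeNat t) (unaryEncodeNat s)) ∧
        (σ x.length s : ℕ∞) < U.ktAt (τ x.length t) x}⟩

/-- The yes-instances of `Gap_{σ,τ}MINKT` are exactly `MINKT` (by definition).
[cite: Hirahara2018, Def. 3.6] -/
@[simp] theorem gapMINKT_yes (σ τ : ℕ → ℕ → ℕ) : (U.gapMINKT σ τ).yes = U.MINKT := rfl

/-- A well-formed triple `⟨x, 1^t, 1^s⟩` is a yes-instance of `Gap_{σ,τ}MINKT` iff `K^t(x) ≤ s`.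
[cite: Hirahara2018, Def. 3.6] -/
theorem boolPair_mem_gapMINKT_yes_iff (σ τ : ℕ → ℕ → ℕ) {x : List Bool} {t s : ℕ} :
    boolPair x (boolPair (unaryEncodeNat t) (unaryEncodeNat s)) ∈ (U.gapMINKT σ τ).yes ↔
      U.ktAt t x ≤ s :=
  U.boolPair_mem_MINKT_iff

/-- A well-formed triple `⟨x, 1^t, 1^s⟩` is a no-instance of `Gap_{σ,τ}MINKT` iff
`σ(|x|, s) < K^{τ(|x|,t)}(x)` (injectivity of `boolPair` and `unaryEncodeNat`).
[cite: Hirahara2018, Def. 3.6] -/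
theorem boolPair_mem_gapMINKT_no_iff (σ τ : ℕ → ℕ → ℕ) {x : List Bool} {t s : ℕ} :
    boolPair x (boolPair (unaryEncodeNat t) (unaryEncodeNat s)) ∈ (U.gapMINKT σ τ).no ↔
      (σ x.length s : ℕ∞) < U.ktAt (τ x.length t) x := by
  constructor
  · rintro ⟨x', t', s', h, hk⟩
    have h1 := boolPair_injective (a₁ := (x, _)) (a₂ := (x', _)) h
    simp only [Prod.mk.injEq] at h1
    obtain ⟨rfl, h2⟩ := h1
    have h3 := boolPair_injective (a₁ := (unaryEncodeNat t, _)) (a₂ := (unaryEncodeNat t', _)) h2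
    simp only [Prod.mk.injEq] at h3
    obtain ⟨ht, hs⟩ := h3
    have ht' : t = t' := by simpa using congr_arg unaryDecodeNat ht
    have hs' : s = s' := by simpa using congr_arg unaryDecodeNat hs
    subst ht' hs'
    exact hk
  · exact fun h => ⟨x, t, s, rfl, h⟩

/-- Under Hirahara's standing hypotheses `s ≤ σ(n,s)` and `t ≤ τ(n,t)`, `Gap_{σ,τ}MINKT` is a
genuine (disjoint) promise problem: `K^{τ(n,t)}(x) ≤ K^t(x) ≤ s ≤ σ(n,s)` on yes-instances
(antitonicity of `K^t` in the budget, `ktAt_anti`). [cite: Hirahara2018, Def. 3.6] -/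
theorem gapMINKT_disjoint {σ τ : ℕ → ℕ → ℕ} (hσ : ∀ n s, s ≤ σ n s) (hτ : ∀ n t, t ≤ τ n t) :
    (U.gapMINKT σ τ).Disjoint := by
  refine Set.disjoint_left.2 ?_
  rintro w ⟨x, t, s, rfl, hyes⟩ hno
  have hno' := (U.boolPair_mem_gapMINKT_no_iff σ τ).1 hno
  have h : U.ktAt (τ x.length t) x ≤ (σ x.length s : ℕ∞) :=
    (U.ktAt_anti (hτ _ _) x).trans (hyes.trans (by exact_mod_cast hσ _ _))
  exact absurd hno' (not_lt.mpr h)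

/-- For `σ(n,s) = s` and `τ(n,t) = t`, `Gap_{σ,τ}MINKT` "coincides with `MINKT`" (Hirahara)
in the following precise sense: its yes-part is `MINKT` and its no-part is the set of
*well-formed* triples outside `MINKT` (malformed strings lie in neither part).
[cite: Hirahara2018, Def. 3.6] -/
theorem gapMINKT_self :
    U.gapMINKT (fun _ s => s) (fun _ t => t) =
      ⟨U.MINKT, {w | ∃ (x : List Bool) (t s : ℕ),
        w = boolPair x (boolPair (unaryEncodeNat t) (unaryEncodeNat s)) ∧ w ∉ U.MINKT}⟩ := by
  unfold gapMINKT
  congr 1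
  ext w
  refine exists₃_congr fun x t s => and_congr_right fun hw => ?_
  rw [hw, boolPair_mem_MINKT_iff, not_le]

/-- The no-part of `Gap_{σ,τ}MINKT` is antitone in both parameters: enlarging the threshold
`σ` or the no-time-bound `τ` (pointwise) only removes no-instances (via `ktAt_anti`).
[cite: Hirahara2018, Def. 3.6] -/
theorem gapMINKT_no_anti {σ σ' τ τ' : ℕ → ℕ → ℕ} (hσ : ∀ n s, σ n s ≤ σ' n s)
    (hτ : ∀ n t, τ n t ≤ τ' n t) : (U.gapMINKT σ' τ').no ≤ (U.gapMINKT σ τ).no := by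
  rintro w ⟨x, t, s, rfl, h⟩
  refine ⟨x, t, s, rfl, ?_⟩
  calc (σ x.length s : ℕ∞) ≤ σ' x.length s := by exact_mod_cast hσ _ _
    _ < U.ktAt (τ' x.length t) x := h
    _ ≤ U.ktAt (τ x.length t) x := U.ktAt_anti (hτ _ _) x

/-! ### `Gap-MK^tP` -/

/-- The gap version `Gap-MK^tP[t₁, t₂; s₁, s₂]` of Liu–Pass/Hirahara's `MK^tP[s]`, for time
bounds `t₁ t₂ : ℕ → ℕ` and thresholds `s₁ s₂ : ℕ → ℕ` (all functions of the input length;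
intended `t₁ ≤ t₂`, `s₁ ≤ s₂`): the promise problem with yes-instances
`{x | K^{t₁(|x|)}(x) ≤ s₁(|x|)} = U.MKtimeP t₁ s₁` and no-instances
`{x | K^{t₂(|x|)}(x) > s₂(|x|)}`. This is `Gap_{σ,τ}MINKT` (Hirahara 2018, Def. 3.6) with the
parameters `t, s` fixed as functions of `|x|` rather than given in the input, i.e. the promise
version of `MK^tP` (Liu–Pass 2020, §2.2) in the pattern of `gapMCSP`.
[cite: Hirahara2018, Def. 3.6] -/
def gapMKtimeP (t₁ t₂ s₁ s₂ : ℕ → ℕ) : PromiseProblem :=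
  ⟨U.MKtimeP t₁ s₁, {x | (s₂ x.length : ℕ∞) < U.kt t₂ x}⟩

/-- The yes-instances of `Gap-MK^tP[t₁,t₂;s₁,s₂]` are `MK^{t₁}P[s₁]` (by definition).
[cite: Hirahara2018, Def. 3.6] -/
@[simp] theorem gapMKtimeP_yes (t₁ t₂ s₁ s₂ : ℕ → ℕ) :
    (U.gapMKtimeP t₁ t₂ s₁ s₂).yes = U.MKtimeP t₁ s₁ := rfl

/-- Membership in the yes-part of `Gap-MK^tP` is `K^{t₁(|x|)}(x) ≤ s₁(|x|)` (definitional).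
[cite: Hirahara2018, Def. 3.6] -/
theorem mem_gapMKtimeP_yes_iff {t₁ t₂ s₁ s₂ : ℕ → ℕ} {x : List Bool} :
    x ∈ (U.gapMKtimeP t₁ t₂ s₁ s₂).yes ↔ U.kt t₁ x ≤ s₁ x.length :=
  Iff.rfl

/-- Membership in the no-part of `Gap-MK^tP` is `s₂(|x|) < K^{t₂(|x|)}(x)` (definitional).
[cite: Hirahara2018, Def. 3.6] -/
theorem mem_gapMKtimeP_no_iff {t₁ t₂ s₁ s₂ : ℕ → ℕ} {x : List Bool} :
    x ∈ (U.gapMKtimeP t₁ t₂ s₁ s₂).no ↔ (s₂ x.length : ℕ∞) < U.kt t₂ x :=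
  Iff.rfl

/-- For `t₁ ≤ t₂` and `s₁ ≤ s₂` pointwise, `Gap-MK^tP[t₁,t₂;s₁,s₂]` is a genuine (disjoint)
promise problem: `K^{t₂}(x) ≤ K^{t₁}(x) ≤ s₁ ≤ s₂` on yes-instances (`ktAt_anti`).
[cite: Hirahara2018, Def. 3.6] -/
theorem gapMKtimeP_disjoint {t₁ t₂ s₁ s₂ : ℕ → ℕ} (ht : ∀ n, t₁ n ≤ t₂ n)
    (hs : ∀ n, s₁ n ≤ s₂ n) : (U.gapMKtimeP t₁ t₂ s₁ s₂).Disjoint := by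
  refine Set.disjoint_left.2 fun x hyes hno => ?_
  have hyes : U.kt t₁ x ≤ s₁ x.length := hyes
  have hno : (s₂ x.length : ℕ∞) < U.kt t₂ x := hno
  have h : U.kt t₂ x ≤ (s₂ x.length : ℕ∞) :=
    (U.ktAt_anti (ht _) x).trans (hyes.trans (by exact_mod_cast hs _))
  exact absurd hno (not_lt.mpr h)

/-- With equal parameters the gap closes: `Gap-MK^tP[t,t;s,s]` is the language `MK^tP[s]`
viewed as a promise problem (`PromiseProblem.ofLanguage`), since `K^t(x) ∈ ℕ∞` is either
`≤ s` or `> s`. [cite: Hirahara2018, Def. 3.6] -/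
theorem gapMKtimeP_self (t s : ℕ → ℕ) :
    U.gapMKtimeP t t s s = PromiseProblem.ofLanguage (U.MKtimeP t s) := by
  unfold gapMKtimeP PromiseProblem.ofLanguage
  congr 1
  ext x
  change (s x.length : ℕ∞) < U.kt t x ↔ ¬ (U.kt t x ≤ s x.length)
  exact not_le.symm

/-- `Gap-MK^tP` is the restriction of `Gap_{σ,τ}MINKT` to parameters given as functions of the
length: `x` is a yes- (resp. no-) instance of `Gap-MK^tP[t₁,t₂;s₁,s₂]` iff the triple
`⟨x, 1^{t₁ |x|}, 1^{s₁ |x|}⟩` is a yes- (resp. no-) instance of `Gap_{σ,τ}MINKT` for any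
`σ, τ` with `σ(|x|, s₁ |x|) = s₂ |x|` and `τ(|x|, t₁ |x|) = t₂ |x|`.
[cite: Hirahara2018, Def. 3.6] -/
theorem mem_gapMKtimeP_iff_boolPair_mem_gapMINKT {t₁ t₂ s₁ s₂ : ℕ → ℕ} {σ τ : ℕ → ℕ → ℕ}
    {x : List Bool} (hσ : σ x.length (s₁ x.length) = s₂ x.length)
    (hτ : τ x.length (t₁ x.length) = t₂ x.length) :
    (x ∈ (U.gapMKtimeP t₁ t₂ s₁ s₂).yes ↔
      boolPair x (boolPair (unaryEncodeNat (t₁ x.length)) (unaryEncodeNat (s₁ x.length))) ∈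
        (U.gapMINKT σ τ).yes) ∧
    (x ∈ (U.gapMKtimeP t₁ t₂ s₁ s₂).no ↔
      boolPair x (boolPair (unaryEncodeNat (t₁ x.length)) (unaryEncodeNat (s₁ x.length))) ∈
        (U.gapMINKT σ τ).no) := by
  refine ⟨?_, ?_⟩
  · rw [boolPair_mem_gapMINKT_yes_iff, mem_gapMKtimeP_yes_iff, kt]
  · rw [boolPair_mem_gapMINKT_no_iff, mem_gapMKtimeP_no_iff, kt, hσ, hτ]

/-- The no-part of `Gap-MK^tP` is antitone in `t₂` and `s₂`: enlarging the no-time-bound or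
the no-threshold (pointwise) only removes no-instances (`ktAt_anti`). [cite: Hirahara2018, Def. 3.6] -/
theorem gapMKtimeP_no_anti {t₁ t₁' t₂ t₂' s₁ s₁' s₂ s₂' : ℕ → ℕ} (ht : ∀ n, t₂ n ≤ t₂' n)
    (hs : ∀ n, s₂ n ≤ s₂' n) :
    (U.gapMKtimeP t₁' t₂' s₁' s₂').no ≤ (U.gapMKtimeP t₁ t₂ s₁ s₂).no := by
  intro x h
  have h : (s₂' x.length : ℕ∞) < U.kt t₂' x := h
  change (s₂ x.length : ℕ∞) < U.kt t₂ x
  calc (s₂ x.length : ℕ∞) ≤ s₂' x.length := by exact_mod_cast hs _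
    _ < U.kt t₂' x := h
    _ ≤ U.kt t₂ x := U.ktAt_anti (ht _) x

/-- The yes-part of `Gap-MK^tP` is monotone in `t₁` and `s₁` (more time / larger threshold
only adds yes-instances; `ktAt_anti`). [cite: LiuPass2020, §2.2] -/
theorem gapMKtimeP_yes_mono {t₁ t₁' t₂ t₂' s₁ s₁' s₂ s₂' : ℕ → ℕ} (ht : ∀ n, t₁ n ≤ t₁' n)
    (hs : ∀ n, s₁ n ≤ s₁' n) :
    (U.gapMKtimeP t₁ t₂ s₁ s₂).yes ≤ (U.gapMKtimeP t₁' t₂' s₁' s₂').yes := by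
  intro x h
  have h : U.kt t₁ x ≤ s₁ x.length := h
  change U.kt t₁' x ≤ s₁' x.length
  calc U.kt t₁' x ≤ U.kt t₁ x := U.ktAt_anti (ht _) x
    _ ≤ s₁ x.length := h
    _ ≤ s₁' x.length := by exact_mod_cast hs _

end UniversalMachine

/-! ### Hirahara's non-black-box worst-case to average-case reduction (statement) -/

/-- **Hirahara 2018, Corollary 4.23** (non-black-box worst-case-to-average-case reduction for
`MINKT`, derandomised form of the full version). *If `DistNP ⊆ AvgP` then
`Gap_{σ,τ}MINKT ∈ Promise-P` for some `σ(n, s) = s + O((log n)·√s + (log n)²)` and some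
polynomial `τ(n, t)`.*

Formalisation conventions: (i) as everywhere in the library the efficient universal machine is
universally quantified (`∀ U : UniversalMachine`; the statement is robust under polynomial
simulation overhead, absorbed by `τ`, and additive `O(1)` description overhead, absorbed by
`σ`); (ii) "`σ(n,s) = s + O((log n)√s + (log n)²)`" is rendered as the explicit bound
`σ n s ≤ s + c·(log₂ n · ⌊√s⌋ + (log₂ n)² + 1)` for some constant `c` (`Nat.log 2`, `Nat.sqrt`;
the `+ 1` absorbs rounding and small `n`), and "polynomial `τ`" as `τ n t ≤ p.eval (n + t)` for
some `p : Polynomial ℕ` — both are *upper* bounds, the direction in which the promise problem is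
hardest, together with Hirahara's standing side conditions `s ≤ σ(n,s)`, `t ≤ τ(n,t)` (Def. 3.6);
(iii) `Promise-P` is `Literature.CplxCore.PromiseP = promiseLift P` (a language in `P` separating yes
from no), `DistNP`, `AvgP` are `Literature.Computability.MetaComplexity.DistNP`, `Literature.Computability.MetaComplexity.AvgP` (Bogdanov–Trevisan
conventions, as in the paper's §3). The randomised form (Thm 4.21 + Fact 3.8: `Promise-ZPP`,
search version) is not vendored. [cite: Hirahara2018, Cor. 4.23] -/
def Hirahara2018_gapMINKT_mem_PromiseP : Prop :=
  ∀ U : UniversalMachine, DistNP ⊆ AvgP →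
    ∃ (σ τ : ℕ → ℕ → ℕ) (c : ℕ) (p : Polynomial ℕ),
      (∀ n s, s ≤ σ n s ∧ σ n s ≤ s + c * (Nat.log 2 n * Nat.sqrt s + Nat.log 2 n ^ 2 + 1)) ∧
      (∀ n t, t ≤ τ n t ∧ τ n t ≤ p.eval (n + t)) ∧
      U.gapMINKT σ τ ∈ PromiseP

end Literature.Computability.MetaComplexity
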